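import Mathlib.NumberTheory.ArithmeticFunction.VonMangoldt
import Mathlib.NumberTheory.ArithmeticFunction.Moebius
import Mathlib.NumberTheory.Chebyshev
import Mathlib.MeasureTheory.Integral.IntervalIntegral.Basic
import Mathlib.Analysis.SpecialFunctions.Integrals.Basic
import Mathlib.Analysis.Complex.Circle
import Mathlib.Data.Fin.Tuple.NatAntidiagonal
import HarnessLib

-- provenance: harness21/H21/H21/Prelude/AntSieve/CircleMethod.lean @ 93a4f70 (interim HEAD d8f2665); M5 mechanical rewrite
/-!
# Circle-method infrastructure (trunk AntSieve, outline C17)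

Basic objects of the Hardy–Littlewood circle method for the binary and ternary Goldbach problems:
the von Mangoldt-weighted exponential sum `S(α) = ∑_{n ≤ N} Λ(n) e(nα)`, major and minor arcs,
the weighted representation counts `∑_{m + n = N} Λ(m) Λ(n)` and its ternary analogue, the singular
integrals, and the truncated Möbius / von Mangoldt functions entering Vaughan's identity.

No target statement of the inventory depends on this file; it only records the standard proof
objects together with a handful of *provable* finite identities (orthogonality, the integral
representation of the weighted counts, Vaughan's identity).

## Mathlib anchors used (not redefined)

* the additive character `e(x) = exp(2πix)` is Mathlib's `Real.fourierChar`, notation `𝐞`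
  (`open scoped FourierTransform`; `Real.fourierChar_apply : 𝐞 x = exp (2πx I)`), coerced from
  `Circle` to `ℂ`;
* `ArithmeticFunction.vonMangoldt` (`Λ`), `ArithmeticFunction.moebius` (`μ`),
  `ArithmeticFunction.zeta` (`ζ`), `ArithmeticFunction.log`, and multiplication of arithmetic
  functions (= Dirichlet convolution);
* `Chebyshev.psi` (`ψ`), `intervalIntegral`, `Finset.antidiagonal`, `Finset.Nat.antidiagonalTuple`.

## Design choices

* Sums over `m + n = N` use `Finset.antidiagonal N` (no `ℕ`-subtraction); triples use
  `Finset.Nat.antidiagonalTuple 3 N`.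
* Arcs follow Vaughan / Helfgott: `𝔐(q, a) = {α ∈ [0, 1] : |α − a/q| ≤ P/N}`, `1 ≤ q ≤ Q`,
  `0 ≤ a ≤ q`, `(a, q) = 1` (both endpoints `a = 0` and `a = q` of the arc around `0 ≡ 1` are
  included so that the arcs live in `[0, 1]`).
* Vaughan's identity is stated as an exact identity of arithmetic functions evaluated at `n > V`
  (three terms; the "fourth term" `Λ_{≤ V}(n)` vanishes precisely because `V < n`), and also in the
  unconditional four-term form `vaughan_identity_add`.

## References

* R. C. Vaughan, *The Hardy–Littlewood Method*, 2nd ed. (1997), ch. 2–3.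
* H. Iwaniec, E. Kowalski, *Analytic Number Theory* (2004), §13.4 (eq. (13.39)), ch. 19.
* H. A. Helfgott, *Major arcs for Goldbach's theorem*, arXiv:1305.2897 (2013), §1 (arc conventions).
-/

noncomputable section

open scoped FourierTransform ArithmeticFunction ArithmeticFunction.Moebius
  ArithmeticFunction.zeta Chebyshev

open Finset MeasureTheory ArithmeticFunction

namespace Literature.NumberTheory.Sieve

/-! ### Exponential sums -/

/-- The von Mangoldt-weighted exponential sum `S(α) = ∑_{1 ≤ n ≤ N} Λ(n) e(nα)` of the circle
method (Vaughan, *The Hardy–Littlewood Method*, §3.1; Iwaniec–Kowalski §19.1). [folklore] -/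
def primeExpSum (N : ℕ) (α : ℝ) : ℂ :=
  ∑ n ∈ Icc 1 N, (Λ n : ℂ) * (𝐞 (n * α) : ℂ)

/-- The prime exponential sum with logarithmic weights `∑_{p ≤ N} (log p) e(pα)`
(Vaughan, *The Hardy–Littlewood Method*, §3.1; Helfgott 2013, §1). [cite: Helfgott2013, §1] -/
def primeExpSumLog (N : ℕ) (α : ℝ) : ℂ :=
  ∑ p ∈ Nat.primesLE N, (Real.log p : ℂ) * (𝐞 (p * α) : ℂ)

/-! ### Major and minor arcs -/

/-- The major arc `𝔐(q, a) = {α ∈ [0, 1] : |α − a/q| ≤ P/N}` around the rational `a/q`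
(Vaughan, *The Hardy–Littlewood Method*, §3.1; Helfgott 2013, §1.1, with `P/N` the arc
half-width). [cite: Helfgott2013, §1.1  with  P/N  the arc half-width] -/
def majorArc (N q : ℕ) (a : ℤ) (P : ℝ) : Set ℝ :=
  {α ∈ Set.Icc (0 : ℝ) 1 | |α - a / q| ≤ P / N}

/-- The major arcs `𝔐 = ⋃_{1 ≤ q ≤ Q} ⋃_{0 ≤ a ≤ q, (a, q) = 1} 𝔐(q, a)`
(Vaughan, *The Hardy–Littlewood Method*, §3.1). [folklore] -/
def majorArcs (N : ℕ) (P Q : ℝ) : Set ℝ :=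
  ⋃ q ∈ Icc 1 ⌊Q⌋₊, ⋃ a ∈ (range (q + 1)).filter (fun a : ℕ ↦ a.Coprime q),
    majorArc N q (a : ℤ) P

/-- The minor arcs `𝔪 = [0, 1] ∖ 𝔐` (Vaughan, *The Hardy–Littlewood Method*, §3.1). [folklore] -/
def minorArcs (N : ℕ) (P Q : ℝ) : Set ℝ :=
  Set.Icc (0 : ℝ) 1 \ majorArcs N P Q

/-! ### Weighted representation counts -/

/-- The weighted binary Goldbach count `R₂(N) = ∑_{m + n = N} Λ(m) Λ(n)`
(Vaughan, *The Hardy–Littlewood Method*, §3.2; Iwaniec–Kowalski §19.1). [folklore] -/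
def weightedGoldbachCount (N : ℕ) : ℝ :=
  ∑ pq ∈ antidiagonal N, Λ pq.1 * Λ pq.2

/-- The weighted ternary Goldbach count `R₃(N) = ∑_{n₁ + n₂ + n₃ = N} Λ(n₁) Λ(n₂) Λ(n₃)`
(Vaughan, *The Hardy–Littlewood Method*, §3.1, Theorem 3.4; Helfgott 2013). [cite: Helfgott2013] -/
def weightedTernaryCount (N : ℕ) : ℝ :=
  ∑ n ∈ Finset.Nat.antidiagonalTuple 3 N, ∏ i, Λ (n i)

/-! ### Singular integrals -/

/-- The unweighted linear exponential sum `T(β) = ∑_{1 ≤ n ≤ N} e(nβ)` approximating `S` on the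
major arcs (Vaughan, *The Hardy–Littlewood Method*, §3.1). [folklore] -/
def linearExpSum (N : ℕ) (β : ℝ) : ℂ :=
  ∑ n ∈ Icc 1 N, (𝐞 (n * β) : ℂ)

/-- The binary singular integral `𝔍₂(N) = ∫_{-1/2}^{1/2} T(β)² e(−Nβ) dβ`
(Vaughan, *The Hardy–Littlewood Method*, §3.2). [folklore] -/
def singularIntegralBinary (N : ℕ) : ℂ :=
  ∫ β in (-1 / 2 : ℝ)..(1 / 2), linearExpSum N β ^ 2 * (𝐞 (-(N * β)) : ℂ)

/-- The ternary singular integral `𝔍₃(N) = ∫_{-1/2}^{1/2} T(β)³ e(−Nβ) dβ`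
(Vaughan, *The Hardy–Littlewood Method*, §3.1, proof of Theorem 3.4). [folklore] -/
def singularIntegralTernary (N : ℕ) : ℂ :=
  ∫ β in (-1 / 2 : ℝ)..(1 / 2), linearExpSum N β ^ 3 * (𝐞 (-(N * β)) : ℂ)

/-! ### Vaughan truncations -/

/-- The truncated Möbius function `μ_{≤ U}(n) = μ(n)` if `n ≤ U` and `0` otherwise
(Iwaniec–Kowalski §13.4; Vaughan, *The Hardy–Littlewood Method*, §3.3). [folklore] -/
def moebiusTrunc (U : ℕ) : ArithmeticFunction ℤ :=
  ⟨fun n ↦ if n ≤ U then μ n else 0, by simp⟩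

/-- The truncated von Mangoldt function `Λ_{≤ V}(n) = Λ(n)` if `n ≤ V` and `0` otherwise
(Iwaniec–Kowalski §13.4; Vaughan, *The Hardy–Littlewood Method*, §3.3). [folklore] -/
def vonMangoldtTrunc (V : ℕ) : ArithmeticFunction ℝ :=
  ⟨fun n ↦ if n ≤ V then Λ n else 0, by simp⟩

/-- Unfolding lemma for `moebiusTrunc` (Iwaniec–Kowalski §13.4). [folklore] -/
@[simp]
theorem moebiusTrunc_apply (U n : ℕ) : moebiusTrunc U n = if n ≤ U then μ n else 0 := rfl

/-- Unfolding lemma for `vonMangoldtTrunc` (Iwaniec–Kowalski §13.4). [folklore] -/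
@[simp]
theorem vonMangoldtTrunc_apply (V n : ℕ) :
    vonMangoldtTrunc V n = if n ≤ V then Λ n else 0 := rfl

/-! ### Orthogonality and integral representations -/

/-- Orthogonality of additive characters on `[0, 1]`: `∫₀¹ e(nα) dα = [n = 0]` for `n ∈ ℤ`
(Vaughan, *The Hardy–Littlewood Method*, §1.2, eq. (1.4)). Provable. [cite: VaughanHL1997, §1.2 eq. (1.4)] -/
def integral_fourierChar_intCast : Prop :=
  ∀ (n : ℤ),
    ∫ α in (0 : ℝ)..1, (𝐞 (n * α) : ℂ) = if n = 0 then 1 else 0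

/-- The fundamental identity of the circle method for binary Goldbach:
`∑_{m + n = N} Λ(m) Λ(n) = ∫₀¹ S(α)² e(−Nα) dα`
(Vaughan, *The Hardy–Littlewood Method*, §3.2; Iwaniec–Kowalski §19.1). Provable from
`integral_fourierChar_intCast`. [cite: VaughanHL1997, §3.2; Iwaniec–Kowalski §19.1] -/
def weightedGoldbachCount_eq_integral : Prop :=
  ∀ (N : ℕ),
    (weightedGoldbachCount N : ℂ) =
      ∫ α in (0 : ℝ)..1, primeExpSum N α ^ 2 * (𝐞 (-(N * α)) : ℂ)

/-- The fundamental identity of the circle method for ternary Goldbach: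
`∑_{n₁ + n₂ + n₃ = N} Λ(n₁) Λ(n₂) Λ(n₃) = ∫₀¹ S(α)³ e(−Nα) dα`
(Vaughan, *The Hardy–Littlewood Method*, §3.1, eq. (3.2)). Provable from
`integral_fourierChar_intCast`. [cite: VaughanHL1997, §3.1 eq. (3.2)] -/
def weightedTernaryCount_eq_integral : Prop :=
  ∀ (N : ℕ),
    (weightedTernaryCount N : ℂ) =
      ∫ α in (0 : ℝ)..1, primeExpSum N α ^ 3 * (𝐞 (-(N * α)) : ℂ)

/-- The trivial bound `|S(α)| ≤ ψ(N)` (Vaughan, *The Hardy–Littlewood Method*, §3.1). Provable: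
`|e(x)| = 1` and `Λ ≥ 0`. [folklore] -/
theorem norm_primeExpSum_le_psi (N : ℕ) (α : ℝ) : ‖primeExpSum N α‖ ≤ ψ N := by
  rw [Chebyshev.psi, Nat.floor_natCast, primeExpSum]
  refine (norm_sum_le _ _).trans (le_of_eq (Finset.sum_congr rfl fun n _ ↦ ?_))
  rw [norm_mul, Circle.norm_coe, mul_one, Complex.norm_real,
    Real.norm_of_nonneg ArithmeticFunction.vonMangoldt_nonneg]

/-! ### Arcs: measurability and disjointness -/

/-- A single major arc is a closed, hence measurable, set (immediate from the definition). [folklore] -/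
theorem measurableSet_majorArc (N q : ℕ) (a : ℤ) (P : ℝ) :
    MeasurableSet (majorArc N q a P) :=
  measurableSet_Icc.inter
    (measurableSet_le (by fun_prop : Measurable fun α : ℝ ↦ |α - a / q|) measurable_const)

/-- The major arcs form a measurable set (finite union of closed sets;
Vaughan, *The Hardy–Littlewood Method*, §3.1). [folklore] -/
theorem measurableSet_majorArcs (N : ℕ) (P Q : ℝ) : MeasurableSet (majorArcs N P Q) :=
  MeasurableSet.biUnion (Finset.countable_toSet _) fun q _ ↦
    MeasurableSet.biUnion (Finset.countable_toSet _) fun a _ ↦ measurableSet_majorArc N q a P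

/-- The minor arcs form a measurable set (Vaughan, *The Hardy–Littlewood Method*, §3.1). [folklore] -/
theorem measurableSet_minorArcs (N : ℕ) (P Q : ℝ) : MeasurableSet (minorArcs N P Q) :=
  measurableSet_Icc.diff (measurableSet_majorArcs N P Q)

/-- Distinct major arcs are disjoint when `2 P Q² < N`: if `a/q ≠ a'/q'` with `q, q' ≤ Q` then
`|a/q − a'/q'| ≥ 1/(q q') ≥ 1/Q² > 2P/N` (Vaughan, *The Hardy–Littlewood Method*, §3.1). The arcs
are indexed by the rational number `a/q`, so that `0/1` and `1/1` count as distinct centres. [cite: VaughanHL1997, §3.1] -/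
def pairwiseDisjoint_majorArc : Prop :=
  ∀ (N : ℕ) (P Q : ℝ) (hN : 2 * P * Q ^ 2 < N),
    Set.PairwiseDisjoint
      {x : ℕ × ℤ | 1 ≤ x.1 ∧ (x.1 : ℝ) ≤ Q ∧ 0 ≤ x.2 ∧ x.2 ≤ x.1 ∧ IsCoprime x.2 (x.1 : ℤ)}
      (fun x : ℕ × ℤ ↦ majorArc N x.1 x.2 P)

/-! ### Vaughan's identity -/

/-- `Λ_{≤ V}(n) = 0` for `n > V` (definition). [folklore] -/
theorem vonMangoldtTrunc_apply_of_lt (V n : ℕ) (hn : V < n) : vonMangoldtTrunc V n = 0 := by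
  simp [vonMangoldtTrunc_apply, Nat.not_le.mpr hn]

/-- **Vaughan's identity**, unconditional four-term form: with `μ_{≤U}`, `Λ_{≤V}` the truncations
and `μ_{>U} = μ − μ_{≤U}`, `Λ_{>V} = Λ − Λ_{≤V}`,
`Λ = Λ_{≤V} + μ_{≤U} * log − μ_{≤U} * Λ_{≤V} * 1 + μ_{>U} * Λ_{>V} * 1`
as arithmetic functions (`*` = Dirichlet convolution). This follows from `Λ_{>V} = Λ_{>V} * μ * 1`,
`μ = μ_{≤U} + μ_{>U}` and `Λ * 1 = log` (Iwaniec–Kowalski, Prop. 13.4, eq. (13.39);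
Vaughan, *The Hardy–Littlewood Method*, §3.3). Provable finite identity. [cite: IwaniecKowalski2004, Prop. 13.4 eq. (13.39); Vaughan §3.3] -/
def vaughan_identity_add : Prop :=
  ∀ (U V : ℕ),
    (Λ : ArithmeticFunction ℝ) =
      vonMangoldtTrunc V + (moebiusTrunc U : ArithmeticFunction ℝ) * ArithmeticFunction.log -
        (moebiusTrunc U : ArithmeticFunction ℝ) * vonMangoldtTrunc V * (ζ : ArithmeticFunction ℝ) +
        ((μ : ArithmeticFunction ℝ) - (moebiusTrunc U : ArithmeticFunction ℝ)) *
          (Λ - vonMangoldtTrunc V) * (ζ : ArithmeticFunction ℝ)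

/-- **Vaughan's identity** (Iwaniec–Kowalski, Prop. 13.4, eq. (13.39); Vaughan 1977;
Vaughan, *The Hardy–Littlewood Method*, §3.3): for `n > V`,
`Λ(n) = ∑_{b ∣ n, b ≤ U} μ(b) log(n/b) − ∑_{bc ∣ n, b ≤ U, c ≤ V} μ(b) Λ(c)
  + ∑_{bc ∣ n, b > U, c > V} μ(b) Λ(c)`,
written with Dirichlet convolutions of the truncated functions. The hypothesis `V < n` kills the
fourth term `Λ_{≤V}(n)` of `vaughan_identity_add`. Provable finite identity. [cite: Vaughan1977] -/
def vaughan_identity : Prop :=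
  ∀ (U V n : ℕ) (hn : V < n),
    (Λ n : ℝ) =
      ((moebiusTrunc U : ArithmeticFunction ℝ) * ArithmeticFunction.log) n -
        ((moebiusTrunc U : ArithmeticFunction ℝ) * vonMangoldtTrunc V *
          (ζ : ArithmeticFunction ℝ)) n +
        (((μ : ArithmeticFunction ℝ) - (moebiusTrunc U : ArithmeticFunction ℝ)) *
          (Λ - vonMangoldtTrunc V) * (ζ : ArithmeticFunction ℝ)) n

/- interim proof relied on results that are now named facts (D-0014); demoted to a fact by the M5 import, proof preserved:
:= by
  have h := congrArg (fun f : ArithmeticFunction ℝ ↦ f n) (vaughan_identity_add U V)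
  rw [h]
  change vonMangoldtTrunc V n + _ - _ + _ = _
  rw [vonMangoldtTrunc_apply_of_lt V n hn, zero_add]
-/

/-! ### Discharged facts -/

/-- Orthogonality of additive characters on `[0, 1]`, `∫₀¹ e(nα) dα = [n = 0]` for `n ∈ ℤ`
(Vaughan, *The Hardy–Littlewood Method*, 2nd ed., §1.2, eq. (1.4)): discharge of the named fact
`integral_fourierChar_intCast`. For `n = 0` the integrand is `1`; for `n ≠ 0` the primitive
`e(nα) / (2πin)` takes the same value at `α = 0` and `α = 1` (Mathlib's
`integral_exp_mul_complex` and `Complex.exp_eq_one_iff`). [cite: VaughanHL1997, §1.2 eq. (1.4)] -/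
theorem integral_fourierChar_intCast_holds : integral_fourierChar_intCast := by
  intro n
  simp_rw [Real.fourierChar_apply]
  split_ifs with hn
  · subst hn; simp
  · have hc : (2 * Real.pi * n * Complex.I : ℂ) ≠ 0 := by
      simp [Real.pi_ne_zero, hn]
    have h : ∀ α : ℝ, Complex.exp (↑(2 * Real.pi * (n * α)) * Complex.I) =
        Complex.exp ((2 * Real.pi * n * Complex.I) * α) := by
      intro α; congr 1; push_cast; ring
    simp_rw [h, integral_exp_mul_complex hc]
    have h1 : Complex.exp (2 * Real.pi * n * Complex.I) = 1 :=
      Complex.exp_eq_one_iff.mpr ⟨n, by ring⟩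
    simp [h1]

/-- **Vaughan's identity**, four-term form: discharge of the named fact `vaughan_identity_add`. In the
commutative ring of real arithmetic functions the right-hand side collapses to `Λ` using only
`μ * ζ = 1` (Möbius inversion, Mathlib `ArithmeticFunction.coe_moebius_mul_coe_zeta`) and
`Λ * ζ = log` (Mathlib `ArithmeticFunction.vonMangoldt_mul_zeta`); the truncations enter as free
variables (Iwaniec–Kowalski, Prop. 13.4, eq. (13.39)). [cite: IwaniecKowalski2004, Prop. 13.4 eq. (13.39)] -/
theorem vaughan_identity_add_holds : vaughan_identity_add := by
  intro U V
  have hμ : ((μ : ArithmeticFunction ℝ) * (ζ : ArithmeticFunction ℝ) : ArithmeticFunction ℝ) = 1 :=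
    coe_moebius_mul_coe_zeta
  have hΛ : (Λ : ArithmeticFunction ℝ) * (ζ : ArithmeticFunction ℝ) = ArithmeticFunction.log :=
    vonMangoldt_mul_zeta
  linear_combination (-((Λ : ArithmeticFunction ℝ) - vonMangoldtTrunc V)) * hμ +
    (moebiusTrunc U : ArithmeticFunction ℝ) * hΛ

/-- **Vaughan's identity** for `n > V` (three-term form): discharge of the named fact
`vaughan_identity`, by evaluating `vaughan_identity_add_holds` at `n` and killing the term
`Λ_{≤V}(n) = 0` (`vonMangoldtTrunc_apply_of_lt`). This restores the interim proof recorded above.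
(Vaughan 1977; Iwaniec–Kowalski, Prop. 13.4.) [cite: Vaughan1977] -/
theorem vaughan_identity_holds : vaughan_identity := by
  intro U V n hn
  have h := congrArg (fun f : ArithmeticFunction ℝ ↦ f n) (vaughan_identity_add_holds U V)
  rw [h]
  change vonMangoldtTrunc V n + _ - _ + _ = _
  rw [vonMangoldtTrunc_apply_of_lt V n hn, zero_add]

end Literature.NumberTheory.Sieve
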